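import Summits.BirchSwinnertonDyer.BirchSwinnertonDyer.Theorems.ByReductionTypeAtTwoOrdKatoHalfAtTwoIsoConjATwoOfPointFieldMu
import Summits.BirchSwinnertonDyer.BirchSwinnertonDyer.Theorems.ByReductionTypeAtTwoFineSelmerConjAAtTwoAdditivePotGoodEisensteinDoor
import Summits.BirchSwinnertonDyer.BirchSwinnertonDyer.Theorems.ByReductionTypeAtTwoFineSelmerConjAAtTwoAdditivePotGoodTwoLayerDoorFukudaRows
import Literature.NumberTheory.NumberFields.QuadraticExtensionOddClassNumberTransfer
import Literature.NumberTheory.NumberFields.AdjoinSqrtNegOneRamificationAtTwo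
import Literature.NumberTheory.NumberFields.AmbiguousClassNumberInequality
import HarnessLib

/-!
# Route `ByReductionTypeAtTwo` (rung K4), crux C1″ `FineSelmerConjAAtTwoAdditivePotGood` (item stmt-BirchSwinnertonDyer-22615):
# THE SIGNATURE GENUS DOOR — (A)₂ with NO Lim fact for a point field `ℚ(P)` with ODD class number, ONE prime above `2` of odd
# `e`, and units of EVERY SIGNATURE (any number of real places; e.g. a TOTALLY REAL cubic field)
# (a `--supports 22615` file; seat `bsd-2adic-k4-w1` GEN 8, lane (b) «Δ_cubic > 0 door rows» of pen RC-472/473/475)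

HONEST FRAMING (cell `bsd-2adic`, D-0036/D-0054/D-0152): THEOREMS ONLY (no definition, no named fact, no `sorry`); PROVED OUTRIGHT,
conditional only on per-field KERNEL-decidable data of ONE number field (the point field `E = ℚ̄^{Stab P}`: class number parity,
splitting of `2`, unit signatures). Closes nothing at the `∀`-level (C1″ 22615 research-open); nothing booked; BSD is not proved by this.

WHY. k4-w2's genus door `conjA_two_of_pointField_genus` (p723127) goes through the sextic carrier `F = E ⊔ ℚ⟮i⟯` and needs `h(F)` odd,
which it gets from Chevalley's formula when `E` has exactly ONE real place (the non-norm `−1` pays for the one ramified real place;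
p722124). For a TOTALLY REAL cubic `E` three real places ramify in `F/E`, and the archimedean factor `2^{r₁(E)}` is cancelled exactly
when the units of `E` take ALL `2^{r₁(E)}` signatures: cruxlead-19573-w2's `AmbiguousClass.padicValNat_two_card_fixed_add_one_le_of_signVec_surjective`
(p724470) gives `ord₂ #Cl(F)^G + 1 ≤ ord₂ h(E) + t` with `t = 1` ramified finite prime, so `#Cl(F)^G` is odd and `h(F)` is odd
(`AmbiguousClass.odd_classNumber_of_odd_card_fixed`). The rest is k4-w2's bridge verbatim (quadratic / Galois / totally complex /
generated by the integer `i`; one prime above `2` in `F` by p722472; Iwasawa 1956; w2's unipotent-dévissage door p718233).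

* §1 `odd_classNumber_of_quadratic_of_signVec_surjective` — the ABSTRACT parity transfer with signatures: `L/K` Galois of degree `2`,
  `L` totally complex, `sign` onto for `K`, `∏ e(L/K) = 2`, `h_K` odd ⟹ `h_L` odd (the unit-signature twin of p722124's
  `odd_classNumber_of_quadratic_of_nrRealPlaces_eq_one`, from p724470's inequality);
  **`conjA_two_of_pointField_genus_of_signVec_surjective`** — `W/ℚ` elliptic, `P ∈ W[2] ∖ 0`, `E = ℚ̄^{Stab P}` of ODD degree with
  unit signature map ONTO (`ComplexTorus.signVec`), `h(E)` odd, exactly one prime above `2` with odd `e` ⟹ (A)₂ at `W` (`∃ γ D`).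
  (For `r₁(E) = 1` the signature hypothesis is automatic from `−1`; this door thus SUBSUMES the one-real-place door.)
* §2 **`conjA_two_of_genus_adjoin_root_of_signVec_surjective`** — the cubic currency: `ℚ̄^{Stab P} = ℚ(β)`, `β` a root of
  `X³ + pX² + qX + r` with `[ℚ(β):ℚ] = 3`, `2 ∤ #Cl(𝓞 ℚ(β))`, one prime above `2`, `sign` onto for `ℚ(β)` ⟹ (A)₂ — «odd `e`» from
  GEN 5's `odd_ramificationIdx_of_existsUnique_two_mem`. The signature input is certified per row by
  `Literature/NumberTheory/NumberFields/CubicFieldUnitSignatureCertificate.lean` (two units, three root intervals).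

Census use: the door row `301392cf1` (`d = 8372`, units `201 − 9θ − θ²`, `692 − 129θ + 6θ²` of independent signs) becomes UNCONDITIONAL
(sequel file); the door row `100560c1` (`d = 1257`) has unit signature rank `2` (`θ² − 2` totally positive, non-square) and a norm
from `K(i)`, so `h(E(i))` is even and NO Iwasawa-1956 road through the sextic carrier exists for it (stays `hLim2`-alone).

References: [CoatesSujatha2005] Conj. A, Thm. 3.4; [Greenberg2001IwasawaPastPresent] Prop. 2.1; [Lang1990] Ch. 13 §4 Lemma 4.1;
[Gras2003] IV.4; [FrohlichTaylor1990] Ch. V §1; tree p718233, p722124, p722472, p723127, p724470.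
-/

set_option autoImplicit false
-- sibling precedent (`…GenusDoorCubic.lean`): the directory name repeats the summit name
set_option linter.dupNamespace false

noncomputable section

open scoped Classical IntermediateField NumberField

namespace Summit.BirchSwinnertonDyer.BirchSwinnertonDyer.Theorems.AddKatoTwo

open WeierstrassCurve Field Polynomial IsDedekindDomain NumberField Literature.NumberTheory.EllipticCurves
  Literature.NumberTheory.GaloisRepresentations
  Literature.NumberTheory.IwasawaTheory Literature.NumberTheory.NumberFields
  Literature.NumberTheory.NumberFields.AmbiguousClass
  Literature.Geometry.Kaehler.ComplexTorus
  Summit.BirchSwinnertonDyer.BirchSwinnertonDyer.Theorems.SteinbergFibreAtTwo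
  Summit.BirchSwinnertonDyer.BirchSwinnertonDyer.Theorems.AlignedTransportAtTwoTorsionPointField
  Summit.BirchSwinnertonDyer.BirchSwinnertonDyer.Theses.ByReductionTypeAtTwo

/-! ## §1 The signature genus door (point field `ℚ̄^{Stab P}`) -/

/-- `[ℚ⟮i⟯ : ℚ] = 2` for `i² = −1`. [folklore] -/
private theorem finrank_adjoin_I' {i : AlgebraicClosure ℚ} (hi : i ^ 2 = -1) (hint : IsIntegral ℚ i) :
    Module.finrank ℚ ↥(IntermediateField.adjoin ℚ ({i} : Set (AlgebraicClosure ℚ))) = 2 := by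
  have h4 : IsPrimitiveRoot i 4 := by
    refine IsPrimitiveRoot.mk_of_lt i (by norm_num) (by rw [show (4 : ℕ) = 2 * 2 by rfl, pow_mul, hi]; norm_num) ?_
    intro k hk hk4
    interval_cases k
    · rw [pow_one]; intro h1; rw [h1] at hi; norm_num at hi
    · rw [hi]; norm_num
    · rw [show (3 : ℕ) = 2 + 1 by rfl, pow_succ, hi]
      intro h; have : i = -1 := by linear_combination -h
      rw [this] at hi; norm_num at hi
  rw [IntermediateField.adjoin.finrank hint, ← Polynomial.cyclotomic_eq_minpoly_rat h4 (by norm_num),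
    Polynomial.natDegree_cyclotomic]
  decide

/-- **Odd class numbers go up a totally complex quadratic extension with ONE ramified finite prime when the units of the base
take EVERY signature** (any number of real places): `L/K` Galois of degree `2`, `L` totally complex, `sign : 𝓞_Kˣ → 𝔽₂^{(K ↪ ℝ)}`
onto, `∏_𝔭 e_𝔭(L/K) = 2`, `h_K` odd ⟹ `h_L` odd. Chevalley with signatures (cruxlead-19573-w2's
`padicValNat_two_card_fixed_add_one_le_of_signVec_surjective`, p724470): `ord₂ #Cl(L)^G + 1 ≤ ord₂ h_K + 1`, so `#Cl(L)^G` is odd, and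
`odd_classNumber_of_odd_card_fixed` (p722124). The unit-signature (Horie) twin of k4-w2's
`odd_classNumber_of_quadratic_of_nrRealPlaces_eq_one`. [cite: Lang1990, Ch. 13 §4, Lemma 4.1 (PDF pp. 203–204)]
[cite: Gras2003, IV.4 (genus theory with signatures)] [cite: FrohlichTaylor1990, Ch. V §1 (1.12), p. 164] -/
theorem odd_classNumber_of_quadratic_of_signVec_surjective {K L : Type} [Field K] [NumberField K] [Field L] [NumberField L]
    [Algebra K L] [IsGalois K L] [IsTotallyComplex L] {σ : L ≃ₐ[K] L} (hσ : ∀ τ : L ≃ₐ[K] L, τ ∈ Subgroup.zpowers σ)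
    (h2 : Module.finrank K L = 2) (hsig : Function.Surjective (signVec (K := K)))
    (hram : (∏ᶠ v : HeightOneSpectrum (𝓞 K), v.asIdeal.ramificationIdxIn (𝓞 L)) = 2) (hK : Odd (classNumber K)) :
    Odd (classNumber L) := by
  haveI : Fact (Nat.Prime 2) := ⟨Nat.prime_two⟩
  have hncard : {v : HeightOneSpectrum (𝓞 K) | v.asIdeal.ramificationIdxIn (𝓞 L) ≠ 1}.ncard = 1 := by
    have h := finprod_ramificationIdxIn_eq_pow_of_prime (K := K) (L := L) Nat.prime_two h2
    rw [hram] at h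
    have h' : 2 ^ 1 = 2 ^ {v : HeightOneSpectrum (𝓞 K) | v.asIdeal.ramificationIdxIn (𝓞 L) ≠ 1}.ncard := by
      rw [pow_one]; exact h
    exact (Nat.pow_right_injective le_rfl h').symm
  have hle := padicValNat_two_card_fixed_add_one_le_of_signVec_surjective (K := K) (L := L) h2 hsig hσ
  have hK0 : padicValNat 2 (classNumber K) = 0 := padicValNat.eq_zero_of_not_dvd hK.not_two_dvd_nat
  rw [hncard, hK0] at hle
  set C := Nat.card {c : ClassGroup (𝓞 L) // ∀ τ : L ≃ₐ[K] L, ClassGroup.mulEquiv (intAut τ) c = c} with hC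
  have hC0 : padicValNat 2 C = 0 := by omega
  have hCpos : C ≠ 0 := by
    rw [hC]
    haveI : Nonempty {c : ClassGroup (𝓞 L) // ∀ τ : L ≃ₐ[K] L, ClassGroup.mulEquiv (intAut τ) c = c} :=
      ⟨⟨1, fun τ ↦ map_one _⟩⟩
    exact Nat.card_pos.ne'
  have hCodd : Odd C := by
    rcases padicValNat.eq_zero_iff.mp hC0 with h | h | h
    · norm_num at h
    · exact absurd h hCpos
    · exact Nat.odd_iff.mpr (Nat.two_dvd_ne_zero.mp h)
  have hσ2 : σ ^ 2 ^ 1 = 1 := by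
    have hc : Fintype.card (L ≃ₐ[K] L) = 2 := by
      rw [← Nat.card_eq_fintype_card, IsGalois.card_aut_eq_finrank, h2]
    rw [pow_one, ← hc]
    exact pow_card_eq_one
  exact odd_classNumber_of_odd_card_fixed hσ hσ2 hCodd

set_option maxHeartbeats 400000 in
/-- **THE SIGNATURE GENUS DOOR.** `W/ℚ` elliptic, `P ∈ W[2] ∖ 0`, `E = ℚ̄^{Stab P}` its point field, of ODD degree. If the unit
signature map `sign : 𝓞_Eˣ → 𝔽₂^{(E ↪ ℝ)}` is ONTO, `h(E)` is ODD, and `E` has exactly ONE prime above `2`, with odd ramification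
index over `2`, then statement (A) holds at `(W, 2)`: for every cyclotomic `ℤ₂`-extension of `ℚ` some fine Selmer dual datum of `W`
over `ℚ_∞` is finitely generated over `ℤ₂`. KERNEL: on the sextic carrier `F = E ⊔ ℚ⟮i⟯` (quadratic Galois totally complex over `E`,
generated by the integer `i`; one prime above `2` and one ramified finite prime by p722472) Chevalley's formula WITH SIGNATURES
(`AmbiguousClass.padicValNat_two_card_fixed_add_one_le_of_signVec_surjective`, p724470) gives `#Cl(F)^G` odd, hence `h(F)` odd, hence
`μ₂ = 0` for every `ℤ₂`-extension of `F` (Iwasawa 1956), and w2's door (p718233) concludes. NO Lim 2017 fact, NO Ferrero–Washington.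
[cite: CoatesSujatha2005, Conj. A and Thm. 3.4] [cite: Greenberg2001IwasawaPastPresent, Prop. 2.1 p. 339]
[cite: Lang1990, Ch. 13 §4, Lemma 4.1 (PDF pp. 203–204)] [cite: FrohlichTaylor1990, Ch. V §1 (1.12), p. 164] -/
theorem conjA_two_of_pointField_genus_of_signVec_surjective (W : WeierstrassCurve ℚ) [W.IsElliptic] {P : geomTorsion W 2}
    (hP : P ≠ 0)
    (hfin : Odd (Module.finrank ℚ ↥(IntermediateField.fixedField (MulAction.stabilizer (absoluteGaloisGroup ℚ) P))))
    (hsig : ∀ [NumberField ↥(IntermediateField.fixedField (MulAction.stabilizer (absoluteGaloisGroup ℚ) P))],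
      Function.Surjective
        (signVec (K := ↥(IntermediateField.fixedField (MulAction.stabilizer (absoluteGaloisGroup ℚ) P)))))
    (hh : Odd (Nat.card (ClassGroup (𝓞 ↥(IntermediateField.fixedField (MulAction.stabilizer (absoluteGaloisGroup ℚ) P))))))
    (h2 : ∃! v : HeightOneSpectrum (𝓞 ↥(IntermediateField.fixedField (MulAction.stabilizer (absoluteGaloisGroup ℚ) P))),
      ((2 : ℕ) : 𝓞 ↥(IntermediateField.fixedField (MulAction.stabilizer (absoluteGaloisGroup ℚ) P))) ∈ v.asIdeal)
    (hodd : ∀ v : HeightOneSpectrum (𝓞 ↥(IntermediateField.fixedField (MulAction.stabilizer (absoluteGaloisGroup ℚ) P))),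
      ((2 : ℕ) : 𝓞 ↥(IntermediateField.fixedField (MulAction.stabilizer (absoluteGaloisGroup ℚ) P))) ∈ v.asIdeal →
        Odd (v.asIdeal.ramificationIdx ℤ)) :
    ∀ (κ : ZpExtension ℚ 2), κ.IsCyclotomic →
      ∃ (γ : absoluteGaloisGroup ℚ) (D : W.FineSelmerDualData κ γ),
        Module.Finite ℤ_[2] (RestrictScalars ℤ_[2] (IwasawaAlgebra 2) D.X) := by
  intro κ hκ
  haveI : Fact (Nat.Prime 2) := ⟨Nat.prime_two⟩
  obtain ⟨i, hi⟩ := IsAlgClosed.exists_pow_nat_eq (-1 : AlgebraicClosure ℚ) two_pos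
  -- the point field is a number field; read the signature hypothesis there
  haveI : FiniteDimensional ℚ ↥(IntermediateField.fixedField (MulAction.stabilizer (absoluteGaloisGroup ℚ) P)) :=
    finiteDimensional_fixedField_stabilizer W P
  haveI : NumberField ↥(IntermediateField.fixedField (MulAction.stabilizer (absoluteGaloisGroup ℚ) P)) := NumberField.mk
  have hsig' : Function.Surjective
      (signVec (K := ↥(IntermediateField.fixedField (MulAction.stabilizer (absoluteGaloisGroup ℚ) P)))) := hsig
  have hfin' := hfin
  -- the two fields
  set E : IntermediateField ℚ (AlgebraicClosure ℚ) :=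
    IntermediateField.fixedField (MulAction.stabilizer (absoluteGaloisGroup ℚ) P) with hE
  set F : IntermediateField ℚ (AlgebraicClosure ℚ) := E ⊔ IntermediateField.adjoin ℚ ({i} : Set (AlgebraicClosure ℚ)) with hF
  have hint : IsIntegral ℚ i := by
    refine ⟨Polynomial.X ^ 2 + 1, Polynomial.monic_X_pow_add_C _ two_ne_zero, ?_⟩
    simp [hi]
  haveI : FiniteDimensional ℚ ↥E := finiteDimensional_fixedField_stabilizer W P
  haveI : FiniteDimensional ℚ ↥(IntermediateField.adjoin ℚ ({i} : Set (AlgebraicClosure ℚ))) :=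
    IntermediateField.adjoin.finiteDimensional hint
  haveI : FiniteDimensional ℚ ↥F := IntermediateField.finiteDimensional_sup E _
  haveI : NumberField ↥E := NumberField.mk
  haveI : NumberField ↥F := NumberField.mk
  -- `i ∉ E` (E has a real place: odd degree), `i ∈ F`
  have hiF : i ∈ F := (le_sup_right : IntermediateField.adjoin ℚ ({i} : Set (AlgebraicClosure ℚ)) ≤ F)
    (IntermediateField.mem_adjoin_simple_self ℚ i)
  have hiE : i ∉ E := by
    intro hiE
    obtain ⟨⟨w, hw⟩⟩ := Fintype.card_pos_iff.mp (InfinitePlace.nrRealPlaces_pos_of_odd_finrank hfin')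
    exact (InfinitePlace.not_isReal_iff_isComplex.mpr (FineSelmerUpstairs.isComplex_of_mem_sq_eq_neg_one i hi E hiE w)) hw
  -- degrees: `[F : ℚ] = 2 [E : ℚ]`
  have hEF : E ≤ F := le_sup_left
  have hlt : Module.finrank ℚ ↥E < Module.finrank ℚ ↥F := by
    refine lt_of_le_of_ne (IntermediateField.finrank_le_of_le_right hEF) fun heq => hiE ?_
    rw [IntermediateField.eq_of_le_of_finrank_eq hEF heq]; exact hiF
  have hle : Module.finrank ℚ ↥F ≤ Module.finrank ℚ ↥E * 2 := by
    have h := IntermediateField.finrank_sup_le E (IntermediateField.adjoin ℚ ({i} : Set (AlgebraicClosure ℚ)))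
    rwa [finrank_adjoin_I' hi hint] at h
  -- the relative structure `E → F`
  letI : Algebra ↥E ↥F := (IntermediateField.inclusion hEF).toRingHom.toAlgebra
  have halg : ∀ e : ↥E, algebraMap ↥E ↥F e = IntermediateField.inclusion hEF e := fun _ => rfl
  haveI : IsScalarTower ℚ ↥E ↥F := IsScalarTower.of_algebraMap_eq fun q =>
    ((IntermediateField.inclusion hEF).commutes q).symm
  haveI : Module.Finite ↥E ↥F := Module.Finite.of_restrictScalars_finite ℚ ↥E ↥F
  have hdeg : Module.finrank ↥E ↥F = 2 := by
    have htower := Module.finrank_mul_finrank ℚ ↥E ↥F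
    have hpos : 0 < Module.finrank ℚ ↥E := Module.finrank_pos
    have h1 : Module.finrank ↥E ↥F ≤ 2 := by
      by_contra h; push Not at h
      have : Module.finrank ℚ ↥E * 3 ≤ Module.finrank ℚ ↥E * Module.finrank ↥E ↥F := Nat.mul_le_mul_left _ h
      omega
    have h2' : Module.finrank ↥E ↥F ≠ 1 := by
      intro h1'; rw [h1', mul_one] at htower; omega
    have h0 : Module.finrank ↥E ↥F ≠ 0 := by
      intro h0'; rw [h0', mul_zero] at htower; omega
    omega
  haveI : Algebra.IsQuadraticExtension ↥E ↥F := ⟨hdeg⟩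
  haveI : IsGalois ↥E ↥F := inferInstance
  haveI : IsTotallyComplex ↥F := ⟨FineSelmerUpstairs.isComplex_of_mem_sq_eq_neg_one i hi F hiF⟩
  -- the integer `x = i ∈ 𝓞 F`, `x² = −1`, generating `F` over `E`
  set y : ↥F := ⟨i, hiF⟩ with hy
  have hy2 : y ^ 2 = -1 := Subtype.ext (by simp [hy, hi])
  have hyint : IsIntegral ℤ y := ⟨Polynomial.X ^ 2 + 1, Polynomial.monic_X_pow_add_C _ two_ne_zero, by simp [hy2]⟩
  set x : 𝓞 ↥F := ⟨y, hyint⟩ with hx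
  have hx2 : x ^ 2 = -1 := by ext; simp [hx, hy2]
  have hxy : (x : ↥F) = y := rfl
  have hgen : Algebra.adjoin ↥E {(x : ↥F)} = ⊤ := by
    rw [hxy]
    have hyE : IsIntegral ↥E y := IsIntegral.tower_top (hyint.tower_top (A := ℚ))
    have hnot : y ∉ (algebraMap ↥E ↥F).range := by
      rintro ⟨e, he⟩
      apply hiE
      have : ((IntermediateField.inclusion hEF e : ↥F) : AlgebraicClosure ℚ) = i := by
        rw [← halg, he]
      rw [IntermediateField.coe_inclusion] at this
      rw [← this]; exact e.2
    have h2le : 2 ≤ (minpoly ↥E y).natDegree := (minpoly.two_le_natDegree_iff hyE).mpr hnot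
    have htop : IntermediateField.adjoin ↥E ({y} : Set ↥F) = ⊤ := by
      refine IntermediateField.eq_of_le_of_finrank_eq le_top ?_
      rw [IntermediateField.adjoin.finrank hyE, IntermediateField.finrank_top', hdeg]
      refine le_antisymm ?_ h2le
      rw [← hdeg, ← IntermediateField.finrank_top', ← IntermediateField.adjoin.finrank hyE]
      exact IntermediateField.finrank_le_of_le_right le_top
    rw [← IntermediateField.adjoin_simple_toSubalgebra_of_isAlgebraic hyE.isAlgebraic, htop, IntermediateField.top_toSubalgebra]
  -- a generator of `Gal(F/E)` (cyclic of order `2`)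
  have hcard : Nat.card (↥F ≃ₐ[↥E] ↥F) = 2 := by rw [IsGalois.card_aut_eq_finrank, hdeg]
  haveI : IsCyclic (↥F ≃ₐ[↥E] ↥F) := isCyclic_of_prime_card (p := 2) hcard
  obtain ⟨σ, hσ⟩ := IsCyclic.exists_generator (α := ↥F ≃ₐ[↥E] ↥F)
  -- (1) ramification above `2`; (2) class number parity by Chevalley WITH SIGNATURES; (3) Iwasawa 1956; (4) w2's door
  have hv : ∃! w : HeightOneSpectrum (𝓞 ↥F), ((2 : ℕ) : 𝓞 ↥F) ∈ w.asIdeal :=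
    existsUnique_two_mem_of_sq_eq_neg_one hdeg hx2 h2 hodd
  have hprod : (∏ᶠ v : HeightOneSpectrum (𝓞 ↥E), v.asIdeal.ramificationIdxIn (𝓞 ↥F)) = 2 :=
    finprod_ramificationIdxIn_eq_two_of_sq_eq_neg_one hdeg hx2 hgen h2 hodd
  have hhE : Odd (classNumber ↥E) := by rwa [NumberField.classNumber, ← Nat.card_eq_fintype_card]
  have hhF : Odd (classNumber ↥F) := odd_classNumber_of_quadratic_of_signVec_surjective hσ hdeg hsig' hprod hhE
  have hhF' : ¬ 2 ∣ Nat.card (ClassGroup (𝓞 ↥F)) := by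
    rw [Nat.card_eq_fintype_card, ← NumberField.classNumber]
    exact hhF.not_two_dvd_nat
  exact PointFieldMu.exists_fineSelmerDualData_moduleFinite_of_classicalMu_pointField_adjoin W hP hi
    (fun κF _ => classicalMuVanishes_two_of_odd_classNumber_of_unique_prime _ hhF' hv κF) κ hκ

/-! ## §2 The cubic currency -/

section Cubic

variable {p q r : ℤ}

/-- **THE SIGNATURE GENUS DOOR IN THE CUBIC CURRENCY (β-root form) — NO Lim fact.** `W/ℚ` elliptic, `P ∈ W[2] ∖ 0` with point field
`ℚ̄^{Stab P} = ℚ(β)`, `β` a root of `X³ + pX² + qX + r` with `[ℚ(β) : ℚ] = 3`; if the unit signature map of `ℚ(β)` is ONTO (e.g. `ℚ(β)`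
totally real with two units of independent signs, `CubicFieldUnitSignatureCertificate`), `2 ∤ #Cl(𝓞 ℚ(β))`, and `ℚ(β)` has exactly
one prime above `2`, then (A)₂ holds at `W`. «Odd `e`» is GEN 5's `odd_ramificationIdx_of_existsUnique_two_mem` (`e f = 3`).
[cite: CoatesSujatha2005, Conj. A and Thm. 3.4] [cite: Greenberg2001IwasawaPastPresent, Prop. 2.1 p. 339]
[cite: FrohlichTaylor1990, Ch. V §1 (1.12), p. 164] -/
theorem conjA_two_of_genus_adjoin_root_of_signVec_surjective (W : WeierstrassCurve ℚ) [W.IsElliptic] {P : geomTorsion W 2}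
    (hP : P ≠ 0) {β : AlgebraicClosure ℚ} (hβ : aeval β (Cubic.toPoly ⟨1, (p : ℚ), q, r⟩) = 0)
    (h3 : Module.finrank ℚ (IntermediateField.adjoin ℚ {β}) = 3)
    (hF : IntermediateField.fixedField (MulAction.stabilizer (absoluteGaloisGroup ℚ) P) = IntermediateField.adjoin ℚ {β})
    (hsig : ∀ [NumberField (IntermediateField.adjoin ℚ {β})],
      Function.Surjective (signVec (K := ↥(IntermediateField.adjoin ℚ {β}))))
    (hh : ¬ 2 ∣ Nat.card (ClassGroup (𝓞 (IntermediateField.adjoin ℚ {β}))))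
    (hv : ∃! v : HeightOneSpectrum (𝓞 (IntermediateField.adjoin ℚ {β})),
      ((2 : ℕ) : 𝓞 (IntermediateField.adjoin ℚ {β})) ∈ v.asIdeal)
    (κ : ZpExtension ℚ 2) (hκ : κ.IsCyclotomic) :
    ∃ (γ : absoluteGaloisGroup ℚ) (D : W.FineSelmerDualData κ γ),
      Module.Finite ℤ_[2] (RestrictScalars ℤ_[2] (IwasawaAlgebra 2) D.X) := by
  have hfm : (Cubic.toPoly ⟨1, (p : ℚ), q, r⟩).Monic := Cubic.monic_of_a_eq_one'
  have hβint : IsIntegral ℚ β := ⟨_, hfm, by rwa [← aeval_def]⟩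
  haveI : FiniteDimensional ℚ (IntermediateField.adjoin ℚ {β}) := IntermediateField.adjoin.finiteDimensional hβint
  haveI : NumberField (IntermediateField.adjoin ℚ {β}) := NumberField.mk
  have hodd3 : Odd (Module.finrank ℚ (IntermediateField.adjoin ℚ {β})) := by rw [h3]; decide
  have hodd : ∀ v : HeightOneSpectrum (𝓞 (IntermediateField.adjoin ℚ {β})),
      ((2 : ℕ) : 𝓞 (IntermediateField.adjoin ℚ {β})) ∈ v.asIdeal → Odd (v.asIdeal.ramificationIdx ℤ) :=
    fun v hv2 => odd_ramificationIdx_of_existsUnique_two_mem _ h3 hv v hv2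
  have hh' : Odd (Nat.card (ClassGroup (𝓞 (IntermediateField.adjoin ℚ {β})))) :=
    Nat.odd_iff.mpr (Nat.two_dvd_ne_zero.mp hh)
  refine conjA_two_of_pointField_genus_of_signVec_surjective W hP ?_ ?_ ?_ ?_ ?_ κ hκ
  · rw [hF]; exact hodd3
  · rw [hF]; exact hsig
  · rw [hF]; exact hh'
  · rw [hF]; exact hv
  · rw [hF]; exact hodd

end Cubic

end Summit.BirchSwinnertonDyer.BirchSwinnertonDyer.Theorems.AddKatoTwo

end
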